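import Summits.HodgeConjecture.HodgeConjecture.Cruxes.BlochSeedDiscOne.FinCheck

/-!
# CoverIntegralityFacts — kernel proofs of the two h = 6 letter facts F1 ∕ F2 of `COVER-INTEGRALITY-JOINT.md` §B.3 (negation g17, pen)

F1: a letter of the height-6 alphabet amply below an alphabet letter with `a = 2` has `a = 0`.
F2: an alphabet letter with `a = 0` is amply below AT MOST ONE alphabet letter with `a = 2`.
Route: `FinCheck.boxList 6 6` (the 169 box letters) and the kernel-evaluable up-lists `FinCheck.upList 6 ℓ`, by `decide`
(the `upList_six_le_nine` pattern), then transport to `Letter.OnAlphabet 6` by `mem_boxList` ∕ `mem_upList`.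
These are the letter inputs of the count law L1⁺ (`CoverIntegralitySketch.CoverCountLaw6`). Sorry-free; no `native_decide`; no instances.
HONEST FRAMING: finite facts about the LETTER model at h = 6; nothing here proves `FloorFree 6 199 8` ∕ `Nonex` ∕ 18881 ∕ H2 ∕ HC_AV ∕ HC_CM ∕ HC.
-/

set_option linter.dupNamespace false
set_option autoImplicit false

namespace Summit.HodgeConjecture.HodgeConjecture.Cruxes.BlochSeedDiscOne.CoverIntegralityFacts

open Summit.HodgeConjecture.HodgeConjecture.Cruxes.BlochSeedDiscOne.DepthBoundA4
open Summit.HodgeConjecture.HodgeConjecture.Cruxes.BlochSeedDiscOne.FinCheck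

set_option maxRecDepth 65536 in
/-- F1, list form: over the 169 box letters with `a ≥ 1`, no letter of the up-list has `a = 2` (kernel `decide`). -/
theorem f1_list : ∀ ℓ ∈ boxList 6 6, 1 ≤ ℓ.a → ∀ q ∈ upList 6 ℓ, q.a ≠ 2 := by decide

set_option maxRecDepth 65536 in
/-- F2, list form: over the box letters with `a = 0`, any two up-list letters with `a = 2` coincide (kernel `decide`). -/
theorem f2_list : ∀ ℓ ∈ boxList 6 6, ℓ.a = 0 → ∀ q₁ ∈ upList 6 ℓ, ∀ q₂ ∈ upList 6 ℓ, q₁.a = 2 → q₂.a = 2 → q₁ = q₂ := by decide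

/-- an alphabet letter is a box letter. -/
theorem mem_boxList_of_onAlphabet {ℓ : Letter} (hℓ : ℓ.OnAlphabet 6) : ℓ ∈ boxList 6 6 := by
  refine mem_boxList.mpr ⟨hℓ.1, ?_, ?_⟩
  · have e := hℓ.1; have h0 := hℓ.2; unfold Letter.height at e
    have := abs_nonneg ℓ.y; push_cast; omega
  · have e := hℓ.1; have h0 := hℓ.2; unfold Letter.height at e
    have := abs_nonneg ℓ.x; push_cast; omega

/-- F1 on the alphabet: below a height-2 letter only height-0 letters. -/
theorem letterFactF1 : ∀ ℓ ℓ' : Letter, ℓ.OnAlphabet 6 → ℓ'.OnAlphabet 6 → ℓ'.a = 2 → AmpleAbove ℓ ℓ' → ℓ.a = 0 := by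
  intro ℓ ℓ' hℓ hℓ' ha2 hA
  have hq : ℓ' ∈ upList 6 ℓ := (mem_upList hℓ).mpr ⟨hℓ', hA⟩
  by_contra h0
  have h1 : 1 ≤ ℓ.a := by have := hℓ.2; omega
  exact f1_list ℓ (mem_boxList_of_onAlphabet hℓ) h1 ℓ' hq ha2

/-- F2 on the alphabet: a height-0 letter lies amply below at most one height-2 letter. -/
theorem letterFactF2 : ∀ ℓ y₁ y₂ : Letter, ℓ.OnAlphabet 6 → y₁.OnAlphabet 6 → y₂.OnAlphabet 6 →
    y₁.a = 2 → y₂.a = 2 → AmpleAbove ℓ y₁ → AmpleAbove ℓ y₂ → y₁ = y₂ := by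
  intro ℓ y₁ y₂ hℓ h₁ h₂ ha₁ ha₂ hA₁ hA₂
  have h0 : ℓ.a = 0 := letterFactF1 ℓ y₁ hℓ h₁ ha₁ hA₁
  exact f2_list ℓ (mem_boxList_of_onAlphabet hℓ) h0 y₁ ((mem_upList hℓ).mpr ⟨h₁, hA₁⟩) y₂ ((mem_upList hℓ).mpr ⟨h₂, hA₂⟩) ha₁ ha₂

end Summit.HodgeConjecture.HodgeConjecture.Cruxes.BlochSeedDiscOne.CoverIntegralityFacts

namespace Summit.HodgeConjecture.HodgeConjecture.Cruxes.BlochSeedDiscOne.CoverIntegralityFacts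

open Summit.HodgeConjecture.HodgeConjecture.Cruxes.BlochSeedDiscOne.DepthBoundA4
open Summit.HodgeConjecture.HodgeConjecture.Cruxes.BlochSeedDiscOne.FinCheck

/-! ## The count law L1⁺ at h = 6 (memo §B.3), kernel: #distinct bottom⁴ N cells ≤ total deep⁴ P mass `D₄`.
Statement = the body of `CoverIntegralitySketch.CoverCountLaw6` (same text; that file imports `DepthBoundA4` only). -/

/-- letters of support cells are alphabet letters. -/
theorem onAlphabet_suppN {D : Design} (hA : D.OnAlphabet 6) {y : Cell} (hy : y ∈ D.suppN) (f : Fin 4) : (y f).OnAlphabet 6 :=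
  hA y (List.mem_append.mpr (Or.inl hy)) f
theorem onAlphabet_suppP {D : Design} (hA : D.OnAlphabet 6) {x : Cell} (hx : x ∈ D.suppP) (f : Fin 4) : (x f).OnAlphabet 6 :=
  hA x (List.mem_append.mpr (Or.inr hx)) f

/-- a live cover of a bottom⁴ cell is deep⁴ (F1 slotwise). -/
theorem deep4_of_live_bottom4 {D : Design} (hA : D.OnAlphabet 6) {x y : Cell} (hx : x ∈ D.suppP) (hy : y ∈ D.suppN)
    (hb : ∀ f : Fin 4, (y f).a = 2) (hl : Live x y) : ∀ f : Fin 4, (x f).a = 0 :=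
  fun f => letterFactF1 (x f) (y f) (onAlphabet_suppP hA hx f) (onAlphabet_suppN hA hy f) (hb f) (hl f)

/-- a deep cover determines the bottom⁴ cell it covers (F2 slotwise). -/
theorem eq_of_live_bottom4 {D : Design} (hA : D.OnAlphabet 6) {x y₁ y₂ : Cell} (hx : x ∈ D.suppP)
    (hy₁ : y₁ ∈ D.suppN) (hy₂ : y₂ ∈ D.suppN) (hb₁ : ∀ f : Fin 4, (y₁ f).a = 2) (hb₂ : ∀ f : Fin 4, (y₂ f).a = 2)
    (hl₁ : Live x y₁) (hl₂ : Live x y₂) : y₁ = y₂ :=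
  funext fun f => letterFactF2 (x f) (y₁ f) (y₂ f) (onAlphabet_suppP hA hx f) (onAlphabet_suppN hA hy₁ f)
    (onAlphabet_suppN hA hy₂ f) (hb₁ f) (hb₂ f) (hl₁ f) (hl₂ f)

/-- mass bookkeeping: the deep⁴ part of the P list has total mass at least the number of distinct deep⁴ support cells. -/
theorem card_deep_suppP_le_mass (D : Design) :
    (D.suppP.filter fun x => ∀ f : Fin 4, (x f).a = 0).toFinset.card ≤
      ((D.P.filter fun cm => ∀ f : Fin 4, (cm.1 f).a = 0).map Prod.snd).sum := by
  classical
  set L := D.P.filter fun cm => ∀ f : Fin 4, (cm.1 f).a = 0 with hL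
  set S := (D.suppP.filter fun x => ∀ f : Fin 4, (x f).a = 0).toFinset with hS
  have hmem : ∀ e ∈ L, 0 < e.2 → e.1 ∈ S := by
    intro e he hpos
    obtain ⟨heP, hdeep⟩ := List.mem_filter.mp he
    have hsupp : e.1 ∈ D.suppP := (mem_suppP_iff D e.1).mpr ⟨e.2, heP, hpos⟩
    exact List.mem_toFinset.mpr (List.mem_filter.mpr ⟨hsupp, by simpa using hdeep⟩)
  rw [total_eq_sum_mult L S hmem, Finset.card_eq_sum_ones]
  refine Finset.sum_le_sum fun c hc => ?_
  obtain ⟨hsupp, hdeep⟩ := List.mem_filter.mp (List.mem_toFinset.mp hc)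
  obtain ⟨m, hm, hpos⟩ := (mem_suppP_iff D c).mp hsupp
  exact (mult_pos_iff L c).mpr ⟨m, List.mem_filter.mpr ⟨hm, by simpa using hdeep⟩, hpos⟩

/-- **L1⁺ COVER COUNT LAW at h = 6 (kernel).** For every (A4) design on the height-6 alphabet, the number of distinct N cells all of
whose letters have `a = 2` is at most the total mass of the P entries all of whose letters have `a = 0`. -/
theorem coverCountLaw6 : ∀ D : Design, D.OnAlphabet 6 → D.A4 →
    ((D.suppN.filter fun y => ∀ f : Fin 4, (y f).a = 2).toFinset.card : ℕ) ≤
      ((D.P.filter fun cm => ∀ f : Fin 4, (cm.1 f).a = 0).map Prod.snd).sum := by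
  classical
  intro D hA h4
  refine le_trans ?_ (card_deep_suppP_le_mass D)
  -- choose a live cover for every N support cell
  have hcov : ∀ y ∈ D.suppN, ∃ x ∈ D.suppP, Live x y := h4.2
  choose! g hg using hcov
  refine Finset.card_le_card_of_injOn g ?_ ?_
  · intro y hy
    obtain ⟨hyN, hb⟩ := List.mem_filter.mp (List.mem_toFinset.mp (Finset.mem_coe.mp hy))
    have hb' : ∀ f : Fin 4, (y f).a = 2 := by simpa using hb
    obtain ⟨hx, hl⟩ := hg y hyN
    exact Finset.mem_coe.mpr (List.mem_toFinset.mpr (List.mem_filter.mpr ⟨hx, by simpa using deep4_of_live_bottom4 hA hx hyN hb' hl⟩))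
  · intro y₁ hy₁ y₂ hy₂ heq
    obtain ⟨hy₁N, hb₁⟩ := List.mem_filter.mp (List.mem_toFinset.mp (Finset.mem_coe.mp hy₁))
    obtain ⟨hy₂N, hb₂⟩ := List.mem_filter.mp (List.mem_toFinset.mp (Finset.mem_coe.mp hy₂))
    have hb₁' : ∀ f : Fin 4, (y₁ f).a = 2 := by simpa using hb₁
    have hb₂' : ∀ f : Fin 4, (y₂ f).a = 2 := by simpa using hb₂
    obtain ⟨hx₁, hl₁⟩ := hg y₁ hy₁N
    obtain ⟨hx₂, hl₂⟩ := hg y₂ hy₂N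
    rw [heq] at hl₁
    exact eq_of_live_bottom4 hA hx₂ hy₁N hy₂N hb₁' hb₂' hl₁ hl₂

end Summit.HodgeConjecture.HodgeConjecture.Cruxes.BlochSeedDiscOne.CoverIntegralityFacts
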